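import Summits.NavierStokesRegularity.NavierStokesRegularity.Theorems.PeepholeVorticityDoorFrame
import Summits.NavierStokesRegularity.NavierStokesRegularity.Theorems.PeepholeVorticityDoorChebyshev
import Summits.NavierStokesRegularity.NavierStokesRegularity.Theorems.PeepholeVorticityDoorUpperXY
import Summits.NavierStokesRegularity.NavierStokesRegularity.Theorems.PeepholeVorticityDoorBudget
import Summits.NavierStokesRegularity.NavierStokesRegularity.Theorems.PeepholeVorticityDoorCoreLower
import Summits.NavierStokesRegularity.NavierStokesRegularity.Theorems.PeepholeVorticityDoorCylinder
import Summits.NavierStokesRegularity.NavierStokesRegularity.Theorems.PeepholeVorticityDoorCarlemanRegion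

/-!
# PeepholeVorticityDoorCore — door S29 «PeepholeVorticityDoor», FILE 2, plate 7: COMPOSITION + DOOR LINE

Text by nsreg-p1 g23 (`r27/plates/PeepholeVorticityDoorCore.lean` e45cc2ef755bda3c, DIRECTOR-NS #137 (3) / #144 (3)), fired by ns-s29-p2 g2
after the six stub plates: B4 `…Chebyshev` (p607004), B2 `…UpperXY` (p607007), B3 `…Budget` (p607093), B1 `…CoreLower` (p607012),
D `…Cylinder` (p608063), A `…CarlemanRegion` (p608064 — ns-s29-lit-1 g0's defeq bridge `regionCarlemanVorticityS29_holds` from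
`Literature.Analysis.FluidPDE.IsClassicalNSSolutionOnRegion.second_carleman_vorticity_region_of_lt`, p607206).  `peepholeToCore_of_stubs` is
ALREADY in `…CoreDefs` (p606267) — not restated; NO statement is declared here.

* `peepholeToCore_holds : PeepholeToCore` — the door's only open hypothesis (Defs §2), i.e. stub 1 of the LINE DOC, now a theorem.
* `targetPeepholeVorticity_holds : TargetPeepholeVorticity` — the door S29 through `targetPeepholeVorticity_of_peepholeToCore` (Frame, p603450).

S29 is a door on the HYPOTHETICAL Type-II-suppression statement 0056: `TargetPeepholeVorticity` is a regularity CRITERION under a hypothetical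
Type-I-frame blow-up (an instance of Tao 2021 Prop. 4.3 / Barker–Prange 2021 Step 1 per nsreg-lit §R127).  Nothing here proves NS regularity,
and 0056 (`NoTypeII`) stays OPEN.
-/

noncomputable section

set_option linter.dupNamespace false

namespace Summit.NavierStokesRegularity.NavierStokesRegularity.Theorems.PeepholeVorticityDoor

/-- FILE 2 («Core»): the door's only open hypothesis `PeepholeToCore` (Defs §2), from the six stub theorems
(Tao's second Carleman inequality at physical scale A, core lower bound B1, upper bounds B2, scalar budget B3, cylinder package D,
Chebyshev pull-back B4) through the kernel-checked composition `peepholeToCore_of_stubs`. -/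
theorem peepholeToCore_holds : PeepholeToCore :=
  peepholeToCore_of_stubs regionCarlemanVorticityS29_holds coreLowerS29_holds upperXYS29_holds
    carlemanBudgetS29_holds cylinderPackageS29_holds chebyshevPullbackS29_holds

/-- DOOR S29 (one-time peephole-vorticity door, every ν, M, ball peephole) — a regularity CRITERION under a
HYPOTHETICAL Type-I-frame blow-up; it does not touch 0056's truth value and proves nothing about NS regularity. -/
theorem targetPeepholeVorticity_holds : TargetPeepholeVorticity :=
  targetPeepholeVorticity_of_peepholeToCore peepholeToCore_holds

end Summit.NavierStokesRegularity.NavierStokesRegularity.Theorems.PeepholeVorticityDoor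

end
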